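import Literature.AlgebraicGeometry.HodgeTheory.PolarizedLimitMixedHodgeStructure
import Literature.AlgebraicGeometry.HodgeTheory.LimitMixedHodgeStructureDual
import Literature.AlgebraicGeometry.Motives.MixedHodgeStructureAbelian
import Literature.AlgebraicGeometry.Motives.MixedHodgeStructureDualDeligneI
import HarnessLib

/-!
# A polarization is an isomorphism `Q♭ : L ⥲ L^∨(-k)` of limit mixed Hodge structures

For a polarized limit mixed Hodge structure `L = (W, F, N, Q)` of weight `k` on the finite-dimensional
`ℚ`-space `V` (the tree's `PolarizedLimitMixedHodgeStructure`: Balnojan–Hertling Def. 3.3 (c),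
Cattani–El Zein–Griffiths–Lê Def. 7.5.9), the map `Q♭ : V → V^∨`, `x ↦ Q(x, ·)`, is an ISOMORPHISM of
limit mixed Hodge structures from `L` onto the Tate twist `L^∨(-k)` of the dual limit mixed Hodge
structure (the tree's `LimitMixedHodgeStructure.dual`: `W_r(V^∨) = (W_{-r-1})^⊥`, `F^p(V^∨) = (F^{1-p})^⊥`,
`N^∨ = -ᵗN`; and `LimitMixedHodgeStructure.tateTwist`). Indeed the three defining conditions on `Q` are
exactly the three conditions on a morphism of limit mixed Hodge structures `L → L^∨(-k)`:

* `Q(W_m) = (W_{2k-1-m})^⊥ = W_m(V^∨(-k))` — the self-duality of the weight filtration of an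
  infinitesimal isometry (Balnojan–Hertling Lemma 3.2 (b) "`S(W_k, W_l) = 0` if `k + l < 2m`"; Schmid,
  Lemma 6.4; the tree's `IsMonodromyWeightFiltration.map_toDual_eq_dualAnnihilator`);
* `Q_ℂ(F^p) ⊆ (F^{k+1-p})^⊥ = F^p(V^∨(-k))` — clause (iii) `Q(F^p, F^{k+1-p}) = 0`;
* `Q♭ ∘ N = (-ᵗN) ∘ Q♭` — `N ∈ 𝔤`, `Q(Nx, y) + Q(x, Ny) = 0`.

This is the mixed analogue of the reading of a polarization of a pure Hodge structure of weight `n` as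
"a morphism `ψ : V ⊗ V → ℚ(-n)` of Hodge structures", equivalently `V → V^∨(-n)` (Deligne, LNM 900, I,
proof of Prop. 3.6; the tree's `Motives.HodgeStructure.Polarization.toDualTwistHom`), and it is how the
polarization enters the category of mixed Hodge structures ("This notion is compatible with passage to
the dual and with tensor products", Cattani et al., Def. 7.5.4; "A morphism of MHS which induces an
isomorphism on the lattices, is an isomorphism of MHS", ibid. p. 161, end of the proof of Thm. 3.2.18 —
the tree's `MixedHodgeStructure.Hom.inverse`).

## Contents

* §1 `LimitMixedHodgeStructure.cast` (re-indexing the weight along `k = k'`), `dualTwist L = L^∨(-k)`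
  as a limit MHS of weight `k` (`-k - 2(-k) = k`), with `dualTwist_W/F/N`.
* §2 **`PolarizedLimitMixedHodgeStructure.toDualHom : Hom L L^∨(-k)`** with underlying map `Q♭ = Q`;
  `qFlat` (`Q♭`), `dualBaseChange_qFlat_baseChange` (`(Q♭)_ℂ` evaluates to `Q_ℂ`); `toDualHom_bijective` (`Q` nondegenerate).
* §3 **`ofDualHom : Hom L^∨(-k) L`**, the inverse morphism (strictness of morphisms of MHS), and the
  two-sided inverse identities: `Q♭` is an ISOMORPHISM of limit mixed Hodge structures; hence
  `map_toDualHom_F : (Q♭)_ℂ(F^p) = F^p(V^∨(-k))` on the nose.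
* §4 Consequence: **the first bilinear relation holds with equality**, `mem_F_iff : x ∈ F^p ↔
  Q_ℂ(x, F^{k+1-p}) = 0`, `F_eq_orthogonal : F^p = (F^{k+1-p})^⊥` (Carlson–Müller-Stach–Peters §4.3
  in the pure case); `Q_baseChange_swap`.
* §5 **Balnojan–Hertling Lemma 3.5 (3.9)**: `Q_baseChange_eq_zero_of_mem_deligneI` —
  `Q_ℂ(I^{p,q}, I^{r,s}) = 0` unless `(r,s) = (k-p, k-q)` (via `Q♭` and the tree's `dual_deligneI`),
  with the weight / Hodge-type / conjugate-type special cases.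

Definitions are structure instances / a re-indexing; no instance, no named fact.
-/

noncomputable section

open scoped TensorProduct

namespace Literature.AlgebraicGeometry.HodgeTheory

open Motives Motives.MixedHodgeStructure
open Motives.HodgeStructure (dualBaseChange dualBaseChange_tmul_tmul)

universe u

variable {V : Type u} [AddCommGroup V] [Module ℚ V] {k k' : ℤ}

/-! ## §1 Re-indexing the weight; `L^∨(-k)` as a limit mixed Hodge structure of weight `k` -/

namespace LimitMixedHodgeStructure

/-- Transport of a limit mixed Hodge structure of weight `k` along an equality of weights `k = k'` (same
`W`, `F`, `N`; only the INDEX of the centre of `W = W(N)[-k]` is re-spelled) — the limit analogue of the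
tree's `Motives.HodgeStructure.cast`, needed because `L^∨(-k)` has weight `-k - 2(-k)`, which is `k` only
up to `ring`. [cite: CattaniElZeinGriffithsLe2014, Def. 7.5.9 (2) and Ex. 3.2.23 (4)] -/
def cast (L : LimitMixedHodgeStructure V k) (h : k = k') : LimitMixedHodgeStructure V k' where
  toMixedHodgeStructure := L.toMixedHodgeStructure
  N := L.N
  isNilpotent_N := L.isNilpotent_N
  map_N_F_le := L.map_N_F_le
  isMonodromyWeightFiltration := h ▸ L.isMonodromyWeightFiltration

/-- `cast` keeps the underlying MHS. [cite: CattaniElZeinGriffithsLe2014, Def. 7.5.9] -/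
@[simp]
theorem cast_toMixedHodgeStructure (L : LimitMixedHodgeStructure V k) (h : k = k') :
    (L.cast h).toMixedHodgeStructure = L.toMixedHodgeStructure := rfl

/-- `cast` keeps `N`. [cite: CattaniElZeinGriffithsLe2014, Def. 7.5.9] -/
@[simp]
theorem cast_N (L : LimitMixedHodgeStructure V k) (h : k = k') : (L.cast h).N = L.N := rfl

/-- `cast` keeps `W`. [cite: CattaniElZeinGriffithsLe2014, Def. 7.5.9] -/
@[simp]
theorem cast_W (L : LimitMixedHodgeStructure V k) (h : k = k') : (L.cast h).W = L.W := rfl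

/-- `cast` keeps `F`. [cite: CattaniElZeinGriffithsLe2014, Def. 7.5.9] -/
@[simp]
theorem cast_F (L : LimitMixedHodgeStructure V k) (h : k = k') : (L.cast h).F = L.F := rfl

variable [FiniteDimensional ℚ V]

/-- **`L^∨(-k)`: the Tate twist by `-k` of the dual limit mixed Hodge structure**, a limit mixed Hodge
structure of weight `k` on `V^∨` (`W_r = (W_{2k-1-r})^⊥`, `F^p = (F^{k+1-p})^⊥`, monodromy logarithm
`-ᵗN`) — the target of the polarization map `Q♭`. [cite: CattaniElZeinGriffithsLe2014, Def. 7.5.4 ("compatible with passage to the dual") and Ex. 3.2.23 (4)]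
[cite: Deligne1980, Prop. (1.6.9) (ii)] -/
abbrev dualTwist (L : LimitMixedHodgeStructure V k) : LimitMixedHodgeStructure (Module.Dual ℚ V) k :=
  (L.dual.tateTwist (-k)).cast (Motives.HodgeStructure.dual_tateTwist_weight k)

/-- `W_r(V^∨(-k)) = (W_{2k-1-r})^⊥`. [cite: Deligne1980, Prop. (1.6.9) (ii)] -/
theorem dualTwist_W (L : LimitMixedHodgeStructure V k) (r : ℤ) :
    L.dualTwist.W r = (L.W (2 * k - 1 - r)).dualAnnihilator := by
  show (L.W (-(r + 2 * -k) - 1)).dualAnnihilator = _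
  congr 2
  ring

/-- `F^p(V^∨(-k)) = (F^{k+1-p})^⊥` (pulled back along `ℂ ⊗ V^∨ → (ℂ ⊗ V)^∨`). [cite: Fujiki1980, (1.6.2) a)] -/
theorem dualTwist_F (L : LimitMixedHodgeStructure V k) (p : ℤ) :
    L.dualTwist.F p = ((L.F (k + 1 - p)).dualAnnihilator).comap (dualBaseChange V) := by
  show ((L.F (1 - (p + -k))).dualAnnihilator).comap (dualBaseChange V) = _
  congr 3
  ring

/-- The monodromy logarithm of `V^∨(-k)` is `-ᵗN`. [cite: Deligne1980, Prop. (1.6.9) (ii)] -/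
@[simp]
theorem dualTwist_N (L : LimitMixedHodgeStructure V k) : L.dualTwist.N = -L.N.dualMap := rfl

end LimitMixedHodgeStructure

/-! ## §2 `Q♭ : L → L^∨(-k)` is a morphism of limit mixed Hodge structures -/

namespace PolarizedLimitMixedHodgeStructure

variable [FiniteDimensional ℚ V] (L : PolarizedLimitMixedHodgeStructure V k)

/-- **`Q♭ : V → V^∨`, `x ↦ Q(x, ·)`** — the polarizing form read as a linear map to the dual space
(the same term as `Q : V →ₗ V →ₗ ℚ`, re-typed so that `Q♭_ℂ : V_ℂ → (V^∨)_ℂ` is its base change).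
[cite: Deligne1982HodgeCycles, I Prop. 3.6 (proof)] -/
def qFlat : V →ₗ[ℚ] Module.Dual ℚ V := L.Q

/-- `Q♭ x = Q(x, ·)`. [cite: Deligne1982HodgeCycles, I Prop. 3.6 (proof)] -/
@[simp]
theorem qFlat_apply (x y : V) : L.qFlat x y = L.Q x y := rfl

/-- `(Q♭)_ℂ` evaluates to `Q_ℂ`: `⟨(Q♭)_ℂ x, y⟩ = Q_ℂ(x, y)` under the comparison
`ℂ ⊗ V^∨ → (ℂ ⊗ V)^∨` (checked on pure tensors). [cite: DeligneHodgeII1971, 1.1.6–1.1.7] -/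
theorem dualBaseChange_qFlat_baseChange (x y : ℂ ⊗[ℚ] V) :
    dualBaseChange V (L.qFlat.baseChange ℂ x) y = L.Q.baseChange ℂ x y := by
  induction x using TensorProduct.induction_on with
  | zero => simp only [map_zero, LinearMap.zero_apply]
  | tmul a v =>
    induction y using TensorProduct.induction_on with
    | zero => simp only [map_zero]
    | tmul b w =>
      rw [LinearMap.baseChange_tmul, dualBaseChange_tmul_tmul, LinearMap.BilinForm.baseChange_tmul,
        qFlat_apply, mul_smul_comm]
    | add y₁ y₂ h₁ h₂ => rw [map_add, map_add, h₁, h₂]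
  | add x₁ x₂ h₁ h₂ => simp only [map_add, LinearMap.add_apply, h₁, h₂]

/-- **`Q♭(W_m) = W_m(V^∨(-k)) = (W_{2k-1-m})^⊥`**: the weight filtration is carried EXACTLY onto the
weight filtration of `L^∨(-k)` (self-duality of `W(N)[-k]` under `Q`, Lemma 3.2 (b)).
[cite: BalnojanHertling2018, Lemma 3.2 (b)] [cite: Schmid1973, §6, Lemma 6.4] -/
theorem map_qFlat_W (m : ℤ) : (L.W m).map L.qFlat = L.dualTwist.W m := by
  rw [LimitMixedHodgeStructure.dualTwist_W]
  have h := L.isMonodromyWeightFiltration.map_toDual_eq_dualAnnihilator L.Q L.nondegenerate_Q L.skew_N m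
  have hcoe : ((L.Q.toDual L.nondegenerate_Q : V ≃ₗ[ℚ] Module.Dual ℚ V) : V →ₗ[ℚ] Module.Dual ℚ V) =
      L.qFlat := LinearMap.ext fun _ => rfl
  rwa [hcoe] at h

/-- **`(Q♭)_ℂ(F^p) ⊆ F^p(V^∨(-k)) = (F^{k+1-p})^⊥`** — clause (iii) `Q(F^p, F^{k+1-p}) = 0`.
[cite: BalnojanHertling2018, Def. 3.3 (c) (iii)] [cite: CattaniElZeinGriffithsLe2014, Def. 7.5.9 (3)] -/
theorem map_qFlat_F_le (p : ℤ) :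
    (L.F p).map (L.qFlat.baseChange ℂ) ≤ L.dualTwist.F p := by
  rintro _ ⟨x, hx, rfl⟩
  rw [LimitMixedHodgeStructure.dualTwist_F, Submodule.mem_comap, Submodule.mem_dualAnnihilator]
  intro y hy
  rw [dualBaseChange_qFlat_baseChange]
  exact L.form_F_eq_zero p x hx y hy

/-- **`Q♭ ∘ N = (-ᵗN) ∘ Q♭`** — `N ∈ 𝔤`: `Q(Nx, ·) = -Q(x, N·)`. [cite: BalnojanHertling2018, Lemma 3.2 (hypothesis)] -/
theorem qFlat_comp_N : L.qFlat ∘ₗ L.N = (-L.N.dualMap) ∘ₗ L.qFlat := by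
  refine LinearMap.ext fun x => LinearMap.ext fun y => ?_
  rw [LinearMap.comp_apply, LinearMap.comp_apply, LinearMap.neg_apply, LinearMap.neg_apply,
    LinearMap.dualMap_apply, qFlat_apply, qFlat_apply, L.skew_N]

/-- **The polarization as a morphism of limit mixed Hodge structures `Q♭ : L → L^∨(-k)`**, `x ↦ Q(x, ·)`
(the mixed analogue of Deligne's "a polarization is a morphism `ψ : V ⊗ V → ℚ(-n)`", LNM 900, I,
Prop. 3.6 proof; here: `Q(W_m) = (W_{2k-1-m})^⊥` (Lemma 3.2 (b)), `Q(F^p) ⊆ (F^{k+1-p})^⊥` (Def. 3.3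
(c) (iii)), `Q ∘ N = -ᵗN ∘ Q` (`N` an infinitesimal isometry)). [cite: Deligne1982HodgeCycles, I Prop. 3.6 (proof)]
[cite: BalnojanHertling2018, Lemma 3.2 (b) and Def. 3.3 (c)] [cite: CattaniElZeinGriffithsLe2014, Def. 7.5.4 and Def. 7.5.9] -/
def toDualHom : LimitMixedHodgeStructure.Hom L.toLimitMixedHodgeStructure L.dualTwist where
  toLinearMap := L.qFlat
  map_W_le m := (L.map_qFlat_W m).le
  map_F_le := L.map_qFlat_F_le
  comm_N := L.qFlat_comp_N

/-- The underlying map of `Q♭` is `Q`. [cite: Deligne1982HodgeCycles, I Prop. 3.6 (proof)] -/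
@[simp]
theorem toDualHom_toLinearMap : L.toDualHom.toLinearMap = L.qFlat := rfl

/-- `Q♭ x = Q(x, ·)`. [cite: Deligne1982HodgeCycles, I Prop. 3.6 (proof)] -/
theorem toDualHom_apply (x y : V) : L.toDualHom.toLinearMap x y = L.Q x y := rfl

/-- **`Q♭ : V ⥲ V^∨` is bijective** (`Q` nondegenerate, `V` finite-dimensional; Mathlib's
`LinearMap.BilinForm.toDual`). [cite: BalnojanHertling2018, Lemma 3.2 (hypothesis "nondegenerate")] -/
theorem toDualHom_bijective : Function.Bijective L.toDualHom.toLinearMap := by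
  have hcoe : ((L.Q.toDual L.nondegenerate_Q : V ≃ₗ[ℚ] Module.Dual ℚ V) : V →ₗ[ℚ] Module.Dual ℚ V) =
      L.toDualHom.toLinearMap := LinearMap.ext fun _ => rfl
  rw [← hcoe]
  exact (L.Q.toDual L.nondegenerate_Q).bijective

/-- `Q♭(W_m) = W_m(V^∨(-k))` ON THE NOSE (not only `⊆`): `Q♭` is strict for `W` with equality.
[cite: BalnojanHertling2018, Lemma 3.2 (b)] -/
theorem map_toDualHom_W (m : ℤ) :
    (L.W m).map L.toDualHom.toLinearMap = L.dualTwist.W m :=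
  L.map_qFlat_W m

/-! ## §3 The inverse: `Q♭` is an isomorphism of limit mixed Hodge structures -/

/-- **The inverse `(Q♭)⁻¹ : L^∨(-k) → L` is a morphism of limit mixed Hodge structures** ("A morphism of
MHS which induces an isomorphism on the lattices, is an isomorphism of MHS", Cattani et al., p. 161 — the
tree's `MixedHodgeStructure.Hom.inverse` — and `(Q♭)⁻¹ ∘ (-ᵗN) = N ∘ (Q♭)⁻¹`). Hence `Q♭ : L ⥲ L^∨(-k)` is
an ISOMORPHISM of limit mixed Hodge structures. [cite: CattaniElZeinGriffithsLe2014, Thm. 3.2.18 (end of proof, p. 161)]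
[cite: Deligne1982HodgeCycles, I Prop. 3.6 (proof)] -/
def ofDualHom : LimitMixedHodgeStructure.Hom L.dualTwist L.toLimitMixedHodgeStructure where
  toHom := L.toDualHom.toHom.inverse L.toDualHom_bijective
  comm_N := by
    refine LinearMap.ext fun ξ => ?_
    obtain ⟨x, rfl⟩ := L.toDualHom_bijective.2 ξ
    have hN : L.dualTwist.N (L.toDualHom.toLinearMap x) = L.toDualHom.toLinearMap (L.N x) :=
      (LinearMap.congr_fun L.toDualHom.comm_N x).symm
    show (LinearEquiv.ofBijective L.toDualHom.toLinearMap L.toDualHom_bijective).symm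
        (L.dualTwist.N (L.toDualHom.toLinearMap x)) =
      L.N ((LinearEquiv.ofBijective L.toDualHom.toLinearMap L.toDualHom_bijective).symm
        (L.toDualHom.toLinearMap x))
    rw [hN, LinearEquiv.ofBijective_symm_apply_apply, LinearEquiv.ofBijective_symm_apply_apply]

/-- The underlying map of `(Q♭)⁻¹` is the inverse linear equivalence. [cite: CattaniElZeinGriffithsLe2014, Thm. 3.2.18] -/
theorem ofDualHom_toLinearMap :
    L.ofDualHom.toLinearMap =
      ((LinearEquiv.ofBijective L.toDualHom.toLinearMap L.toDualHom_bijective).symm :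
        Module.Dual ℚ V →ₗ[ℚ] V) := rfl

/-- `(Q♭)⁻¹ ∘ Q♭ = id`. [cite: CattaniElZeinGriffithsLe2014, Thm. 3.2.18] -/
@[simp]
theorem ofDualHom_toDualHom_apply (x : V) :
    L.ofDualHom.toLinearMap (L.toDualHom.toLinearMap x) = x := by
  rw [ofDualHom_toLinearMap, LinearEquiv.coe_coe, LinearEquiv.ofBijective_symm_apply_apply]

/-- `Q♭ ∘ (Q♭)⁻¹ = id`. [cite: CattaniElZeinGriffithsLe2014, Thm. 3.2.18] -/
@[simp]
theorem toDualHom_ofDualHom_apply (ξ : Module.Dual ℚ V) :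
    L.toDualHom.toLinearMap (L.ofDualHom.toLinearMap ξ) = ξ := by
  rw [ofDualHom_toLinearMap, LinearEquiv.coe_coe]
  exact (LinearEquiv.ofBijective L.toDualHom.toLinearMap L.toDualHom_bijective).apply_symm_apply ξ

/-- `(Q♭)⁻¹ ∘ Q♭ = id` as morphisms `L → L`. [cite: CattaniElZeinGriffithsLe2014, Thm. 3.2.18] -/
theorem ofDualHom_comp_toDualHom :
    L.ofDualHom.toLinearMap ∘ₗ L.toDualHom.toLinearMap = LinearMap.id :=
  LinearMap.ext L.ofDualHom_toDualHom_apply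

/-- `Q♭ ∘ (Q♭)⁻¹ = id` as morphisms `L^∨(-k) → L^∨(-k)`. [cite: CattaniElZeinGriffithsLe2014, Thm. 3.2.18] -/
theorem toDualHom_comp_ofDualHom :
    L.toDualHom.toLinearMap ∘ₗ L.ofDualHom.toLinearMap = LinearMap.id :=
  LinearMap.ext L.toDualHom_ofDualHom_apply

/-- **`(Q♭)_ℂ(F^p) = F^p(V^∨(-k))` ON THE NOSE** (strictness of the isomorphism `Q♭`: the Hodge
filtration of `L` is carried exactly onto the dual-twisted one). [cite: CattaniElZeinGriffithsLe2014, Thm. 3.2.18] -/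
theorem map_toDualHom_F (p : ℤ) :
    (L.F p).map (L.toDualHom.toLinearMap.baseChange ℂ) = L.dualTwist.F p := by
  refine le_antisymm (L.toDualHom.map_F_le p) ?_
  intro ξ hξ
  have h := L.ofDualHom.map_F_le p ⟨ξ, hξ, rfl⟩
  refine ⟨_, h, ?_⟩
  rw [← LinearMap.comp_apply, ← LinearMap.baseChange_comp, toDualHom_comp_ofDualHom,
    LinearMap.baseChange_id, LinearMap.id_apply]

/-- `(Q♭)_ℂ : V_ℂ → (V^∨)_ℂ` is injective (it has the left inverse `((Q♭)⁻¹)_ℂ`). [cite: CattaniElZeinGriffithsLe2014, Thm. 3.2.18] -/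
theorem baseChange_toDualHom_injective :
    Function.Injective (L.toDualHom.toLinearMap.baseChange ℂ) := by
  refine Function.LeftInverse.injective (g := L.ofDualHom.toLinearMap.baseChange ℂ) fun z => ?_
  rw [← LinearMap.comp_apply, ← LinearMap.baseChange_comp, ofDualHom_comp_toDualHom,
    LinearMap.baseChange_id, LinearMap.id_apply]

/-! ## §4 Consequence: the first bilinear relation holds with equality, `F^p = (F^{k+1-p})^⊥` -/

/-- `Q_ℂ(y, x) = (-1)^k · Q_ℂ(x, y)`: the `(-1)^k`-symmetry of `Q` after complexification.
[cite: BalnojanHertling2018, Def. 3.3 (c) (i) and Lemma 3.2] -/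
theorem Q_baseChange_swap (x y : ℂ ⊗[ℚ] V) :
    L.Q.baseChange ℂ y x = (((k.negOnePow : ℤˣ) : ℤ) : ℂ) * L.Q.baseChange ℂ x y := by
  induction x using TensorProduct.induction_on with
  | zero => simp only [map_zero, LinearMap.zero_apply, mul_zero]
  | tmul a v =>
    induction y using TensorProduct.induction_on with
    | zero => simp only [map_zero, LinearMap.zero_apply, mul_zero]
    | tmul b w =>
      rw [LinearMap.BilinForm.baseChange_tmul, LinearMap.BilinForm.baseChange_tmul, L.Q_swap v w,
        mul_comm b a]
      simp only [Algebra.smul_def, eq_ratCast, Rat.cast_mul, Rat.cast_intCast]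
      ring
    | add y₁ y₂ h₁ h₂ => simp only [map_add, LinearMap.add_apply, h₁, h₂, mul_add]
  | add x₁ x₂ h₁ h₂ => simp only [map_add, LinearMap.add_apply, h₁, h₂, mul_add]

/-- **`x ∈ F^p ↔ Q_ℂ(x, F^{k+1-p}) = 0`: the first bilinear relation (iii) `Q(F^p, F^{k+1-p}) = 0`
holds with EQUALITY, `F^p = (F^{k+1-p})^⊥`** — because `Q♭ : L ⥲ L^∨(-k)` is an isomorphism of mixed
Hodge structures, hence carries `F^p` exactly onto `F^p(V^∨(-k)) = (F^{k+1-p})^⊥` (`map_toDualHom_F`).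
This is the limit analogue of "the first relation is equivalent to `(F^p)^⊥ = F^{w-p+1}`".
[cite: CarlsonMullerStachPeters2017, §4.3 (first bilinear relation, `(F^p)^⊥ = F^{w-p+1}`)]
[cite: BalnojanHertling2018, Def. 3.3 (c) (iii)] [cite: CattaniElZeinGriffithsLe2014, Thm. 3.2.18 (p. 161)] -/
theorem mem_F_iff (p : ℤ) (x : ℂ ⊗[ℚ] V) :
    x ∈ L.F p ↔ ∀ y ∈ L.F (k + 1 - p), L.Q.baseChange ℂ x y = 0 := by
  refine ⟨fun hx y hy => L.form_F_eq_zero p x hx y hy, fun h => ?_⟩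
  have hmem : L.toDualHom.toLinearMap.baseChange ℂ x ∈ L.dualTwist.F p := by
    rw [LimitMixedHodgeStructure.dualTwist_F, Submodule.mem_comap, Submodule.mem_dualAnnihilator]
    intro y hy
    rw [toDualHom_toLinearMap, dualBaseChange_qFlat_baseChange]
    exact h y hy
  rw [← map_toDualHom_F] at hmem
  obtain ⟨x', hx', hxx'⟩ := hmem
  rw [← L.baseChange_toDualHom_injective hxx']
  exact hx'

/-- **`F^p = (F^{k+1-p})^⊥`** (`Q_ℂ`-orthogonal complement, Mathlib's `LinearMap.BilinForm.orthogonal`).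
[cite: CarlsonMullerStachPeters2017, §4.3 (first bilinear relation, `(F^p)^⊥ = F^{w-p+1}`)]
[cite: BalnojanHertling2018, Def. 3.3 (c) (iii)] -/
theorem F_eq_orthogonal (p : ℤ) : L.F p = (L.Q.baseChange ℂ).orthogonal (L.F (k + 1 - p)) := by
  ext x
  rw [mem_F_iff, LinearMap.BilinForm.mem_orthogonal_iff]
  refine forall₂_congr fun y _ => ?_
  rw [L.Q_baseChange_swap x y, mul_eq_zero, or_iff_right (Int.cast_ne_zero.2 k.negOnePow.ne_zero)]

/-- `F^{k+1-p} = (F^p)^⊥` (the same relation read from the other side).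
[cite: CarlsonMullerStachPeters2017, §4.3 (first bilinear relation, `(F^p)^⊥ = F^{w-p+1}`)] -/
theorem F_eq_orthogonal' (p : ℤ) : L.F (k + 1 - p) = (L.Q.baseChange ℂ).orthogonal (L.F p) := by
  rw [L.F_eq_orthogonal (k + 1 - p), sub_sub_cancel]

/-! ## §5 Balnojan–Hertling, Lemma 3.5 (3.9): `Q(I^{p,q}, I^{r,s}) = 0` unless `(r,s) = (k-p, k-q)` -/

/-- `Q♭` as a morphism of mixed Hodge structures `L → L^∨(-k)` in the tree's `tateTwist` form (the MHS
underlying `L.dualTwist` is `(L^∨)(-k)` definitionally). [cite: Deligne1982HodgeCycles, I Prop. 3.6 (proof)] -/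
def toDualMHSHom :
    MixedHodgeStructure.Hom L.toMixedHodgeStructure (L.toMixedHodgeStructure.dual.tateTwist (-k)) :=
  L.toDualHom.toHom

/-- The underlying map of `toDualMHSHom` is `Q♭`. [cite: Deligne1982HodgeCycles, I Prop. 3.6 (proof)] -/
@[simp]
theorem toDualMHSHom_toLinearMap : L.toDualMHSHom.toLinearMap = L.qFlat := rfl

/-- **`Q♭` carries Deligne's bigrading of `L` into that of `L^∨`: `(Q♭)_ℂ I^{p,q}(L) ⊆ I^{p-k,q-k}(L^∨)`**
(morphisms of MHS respect `I^{•,•}`, `Q♭ : L → L^∨(-k)` has type `(-k,-k)`; Balnojan–Hertling (3.3)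
"compatible with all morphisms", Green–Griffiths–Kerr (I.C.2) (ii)). [cite: BalnojanHertling2018, Lemma 3.5]
[cite: GreenGriffithsKerr2012, Prop. (I.C.2) (ii)] -/
theorem map_qFlat_deligneI_le (p q : ℤ) :
    (L.toMixedHodgeStructure.deligneI p q).map (L.qFlat.baseChange ℂ) ≤
      L.toMixedHodgeStructure.dual.deligneI (p - k) (q - k) := by
  have h := MixedHodgeStructure.Hom.map_deligneI_le_of_tateTwist L.toDualMHSHom p q
  rwa [toDualMHSHom_toLinearMap, ← sub_eq_add_neg, ← sub_eq_add_neg] at h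

/-- **Lemma 3.5 (3.9): `Q_ℂ(I^{p,q}, I^{r,s}) = 0` for `(r,s) ≠ (k-p, k-q)`** — the polarizing form pairs
Deligne's pieces of the limit mixed Hodge structure only in complementary bidegrees ("In the case of a
PMHS of weight `m` with polarizing form `S`: `S(I^{p,q}, I^{r,s}) = 0` for `(r,s) ≠ (m-p, m-q)`"): `Q♭`
maps `I^{p,q}(L)` into `I^{p-k,q-k}(L^∨) = (⊕_{(r,s) ≠ (k-p,k-q)} I^{r,s}(L))^⊥` (the tree's `dual_deligneI`).
[cite: BalnojanHertling2018, Lemma 3.5 (3.9)] -/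
theorem Q_baseChange_eq_zero_of_mem_deligneI {p q r s : ℤ} (hrs : (r, s) ≠ (k - p, k - q))
    {x y : ℂ ⊗[ℚ] V} (hx : x ∈ L.toMixedHodgeStructure.deligneI p q)
    (hy : y ∈ L.toMixedHodgeStructure.deligneI r s) : L.Q.baseChange ℂ x y = 0 := by
  rw [← dualBaseChange_qFlat_baseChange]
  refine L.toMixedHodgeStructure.dualBaseChange_apply_eq_zero_of_mem_deligneI (p := p - k) (q := q - k)
    (r := r) (s := s) ?_ (L.map_qFlat_deligneI_le p q ⟨x, hx, rfl⟩) hy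
  simpa only [neg_sub] using hrs

/-- (3.9), the flipped form: `Q_ℂ(I^{r,s}, I^{p,q}) = 0` for `(r,s) ≠ (k-p, k-q)`.
[cite: BalnojanHertling2018, Lemma 3.5 (3.9)] -/
theorem Q_baseChange_eq_zero_of_mem_deligneI' {p q r s : ℤ} (hrs : (r, s) ≠ (k - p, k - q))
    {x y : ℂ ⊗[ℚ] V} (hx : x ∈ L.toMixedHodgeStructure.deligneI p q)
    (hy : y ∈ L.toMixedHodgeStructure.deligneI r s) : L.Q.baseChange ℂ y x = 0 := by
  rw [L.Q_baseChange_swap x y, L.Q_baseChange_eq_zero_of_mem_deligneI hrs hx hy, mul_zero]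

/-- **`Q_ℂ(I^{p,q}, I^{r,s}) = 0` unless the total weights add up to `2k`** (`p + q + r + s = 2k`).
[cite: BalnojanHertling2018, Lemma 3.5 (3.9) and Lemma 3.2 (b)] -/
theorem Q_baseChange_eq_zero_of_mem_deligneI_of_weight_ne {p q r s : ℤ} (h : p + q + r + s ≠ 2 * k)
    {x y : ℂ ⊗[ℚ] V} (hx : x ∈ L.toMixedHodgeStructure.deligneI p q)
    (hy : y ∈ L.toMixedHodgeStructure.deligneI r s) : L.Q.baseChange ℂ x y = 0 :=
  L.Q_baseChange_eq_zero_of_mem_deligneI (fun hrs => h (by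
    obtain ⟨h1, h2⟩ := Prod.ext_iff.1 hrs
    simp only at h1 h2
    omega)) hx hy

/-- **`Q_ℂ(I^{p,q}, I^{r,s}) = 0` unless `p + r = k`** (the Hodge-type half of (3.9); compare the first
bilinear relation `Q(F^p, F^{k+1-p}) = 0`). [cite: BalnojanHertling2018, Lemma 3.5 (3.9) and Def. 3.3 (c) (iii)] -/
theorem Q_baseChange_eq_zero_of_mem_deligneI_of_fst_ne {p q r s : ℤ} (h : p + r ≠ k)
    {x y : ℂ ⊗[ℚ] V} (hx : x ∈ L.toMixedHodgeStructure.deligneI p q)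
    (hy : y ∈ L.toMixedHodgeStructure.deligneI r s) : L.Q.baseChange ℂ x y = 0 :=
  L.Q_baseChange_eq_zero_of_mem_deligneI (fun hrs => h (by
    obtain ⟨h1, -⟩ := Prod.ext_iff.1 hrs
    simp only at h1
    omega)) hx hy

/-- **`Q_ℂ(I^{p,q}, I^{r,s}) = 0` unless `q + s = k`** (the conjugate half of (3.9)).
[cite: BalnojanHertling2018, Lemma 3.5 (3.9)] -/
theorem Q_baseChange_eq_zero_of_mem_deligneI_of_snd_ne {p q r s : ℤ} (h : q + s ≠ k)
    {x y : ℂ ⊗[ℚ] V} (hx : x ∈ L.toMixedHodgeStructure.deligneI p q)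
    (hy : y ∈ L.toMixedHodgeStructure.deligneI r s) : L.Q.baseChange ℂ x y = 0 :=
  L.Q_baseChange_eq_zero_of_mem_deligneI (fun hrs => h (by
    obtain ⟨-, h2⟩ := Prod.ext_iff.1 hrs
    simp only at h2
    omega)) hx hy

end PolarizedLimitMixedHodgeStructure

end Literature.AlgebraicGeometry.HodgeTheory

end
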